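import Summits.AtomisticToContinuum.BoseEinsteinCondensation.Theorems.BoxCountShadowCoercivity
import Summits.AtomisticToContinuum.BoseEinsteinCondensation.Theorems.BoxCountShadowCellEnergy
import Summits.AtomisticToContinuum.BoseEinsteinCondensation.Theorems.BoxCountShadowCellProfile
import Summits.AtomisticToContinuum.BoseEinsteinCondensation.Theorems.BoxCountShadowClosedToTrial
import HarnessLib

/-!
# BoxCountShadowCoercivityLine — COERC_h = `GroundStateHorizonCellCoercivity η` is a THEOREM (all `η ≥ 0`)

The three pieces of the Lieb–Yngvason cell method at the horizon scale, ALL PROVED in tree-importing files, and the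
kernel-checked composition `GroundStateHorizonCellCoercivity_of : CellDecomposition → CellProfile η → ClosedToTrial →
GroundStateHorizonCellCoercivity η`; hence `groundStateHorizonCellCoercivity_holds (η) : GroundStateHorizonCellCoercivity η`
and, through `BoxCountShadowCoercivity` / `BoxCountShadowTruncation`, the truncated density LLN
`densityLLNTrunc_holds (η) : GroundStateHorizonDensityLLNTrunc η`, the ring share `horizonRingShare_holds (η) :
GroundStateHorizonRingShare η`, and the one-hypothesis forms `horizonCellInsertion_of_displacement'`,
`horizonCellCountAffinity_of_displacement' : GroundStateHorizonDisplacement η → GroundStateHorizonCellCountAffinity η`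
(the residual of record MARG_h now rests on DISP_h ALONE) and `bec_of_displacement₃`.

* `cellDecomposition` (S1, `BoxCountShadowCellEnergy.cellDecomposition_holds`): for every Dirichlet trial state `Ψ` of
  `N = n+1` bosons in `Λ_L` and every `K ≥ 1`, `∫ Σ_B E₀^N(N_B(X), L/K) |Ψ(X)|² dX ≤ ⟨Ψ, H Ψ⟩` — the cell
  decomposition (2.52)–(2.53) of [LSSY2005] in COUNT language (`N_B(X) = countVec (L/K) K X B`).
* `cellProfile` (S2, `BoxCountShadowCellProfile.cellProfile_holds`): the per-count-vector COERCIVE PROFILE: for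
  `ρ < ρ₀(v, M, e)`, every `n`, every `K` in the horizon window and every `m ∈ ℕ^{K³}` with `Σ m = N`,
  `4πρa(1−e)N · (1 + Σ_B K⁻³ min((m_B/λ − 1)², 1)) ≤ Σ_B E₀^N(m_B, ℓ) + 4πρa·e·N` (`ℓ = L/K`, `λ = N/K³ = ρℓ³`):
  Thm 2.4 (Neumann, `LSSY2005_lowerBound_neumann_holds`) on cells with `x = m_B/λ ≤ 9`, superadditivity
  (`LSSY2005_superadditivity_holds`) pricing dense cells LINEARLY, and the convex minorant
  `g(x) = x² (x ≤ 8), 2x (x > 8) ≥ (2x − 1) + min((x−1)², 1)`.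
* `closedToTrial` (S3, `BoxCountShadowClosedToTrial.closedToTrial_holds`): from the CLOSED form to the `C¹` core:
  if `closedEnergy v L Φ < E` then some trial state `Ψ` has `energy v Ψ < E` and
  `countVarianceTrunc L K Φ ≤ countVarianceTrunc L K |Ψ| + δ` (`closedEnergy` = `iInf` of `liminf`s over
  `L²`-approximating trial sequences, and `V_T(Φ) ≤ V_T(|Ψ|) + t + (1+1/t)‖Ψ − Φ‖₂²`).

Also proved here: `sum_countVec_eq` (the horizon cells tile the box: `Σ_B N_B(X) = N` on `Λ_L^N`),
`lintegral_truncWeight_mul` (`∫ w_K(X)|ψ|² = countVarianceTrunc L K |ψ|`), `trialCoercivity`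
(`c₁(1 + V_T(|Ψ|)) ≤ ⟨Ψ,HΨ⟩ + c₂` for trial states).  No instances, no notation, no sorry.
-/

namespace Summit.AtomisticToContinuum.BoseEinsteinCondensation.Theorems.BoxCountShadow.CoercivityLine

open MeasureTheory Filter Set
open scoped ENNReal NNReal BigOperators
open Literature.MathematicalPhysics.QuantumManyBody.BoseGas
open Summit.AtomisticToContinuum.BoseEinsteinCondensation.Theorems.BoxLatticeFSum
open Summit.AtomisticToContinuum.BoseEinsteinCondensation.Theorems.BoxLabelAffinity
open Summit.AtomisticToContinuum.BoseEinsteinCondensation.Theorems.BoxHorizonAffinity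
open Summit.AtomisticToContinuum.BoseEinsteinCondensation.Theorems.BoxCountShadow

variable {n : ℕ}

/-! ### The three pieces (all proved; `truncWeight` is `BoxCountShadowCellProfile.truncWeight`) -/

/-- **S1 — cell decomposition in count language** (proved: `cellDecomposition` below, from
`BoxCountShadowCellEnergy.lintegral_cellEnergySum_mul_le_energy`). For every Dirichlet trial state and every
`K ≥ 1`, `∫ F_K(X) |Ψ(X)|² dX ≤ ⟨Ψ, H_N Ψ⟩`. (Source: LSSY2005, (2.52)–(2.53); proved in-file, so not a cited fact.) -/
def CellDecomposition : Prop :=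
  ∀ v : ℝ → ℝ≥0∞, Measurable v → ∀ (n : ℕ) (L : ℝ), 0 < L → ∀ K : ℕ, 0 < K →
    ∀ Ψ : TrialState (n + 1) L,
      ∫⁻ X, cellEnergySum v L K X * (‖Ψ.ψ X‖₊ : ℝ≥0∞) ^ 2 ≤ energy v Ψ

/-- **S2 — the coercive cell profile at the horizon scale.** For `ρ < ρ₀(v, M, e)`, all `n`, all `K` in the
window `InWindow (Mρ^{-η}) ρ L K` and all count vectors `m` with `Σ m = n+1`:
`4πρa(1−e)(n+1)·(1 + w_K(m)) ≤ Σ_B E₀^N(m_B, L/K) + 4πρa·e·(n+1)`.  Why plausibly true: Thm 2.4 (tree theorem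
`LSSY2005_lowerBound_neumann_holds`) per cell for `x_B ≤ 8`, superadditivity (`LSSY2005_superadditivity_holds`)
for `x_B > 8`, and the convex minorant `g(x) ≥ (2x−1) + min((x−1)²,1)` with `Σ_B K⁻³x_B = 1` (module
docstring).  Why it might fail: only bookkeeping (threshold `x_lo → 0` needs `η ≥ 0`, `λ = ρℓ³ → ∞`).  Size M/L.
(Source: LSSY2005, Thm. 2.4, (2.47), (2.53)–(2.59); proved in-file, so not a cited fact.) -/
def CellProfile (η : ℝ≥0) : Prop :=
  ∀ v : ℝ → ℝ≥0∞, IsRepulsiveFiniteRange v → 0 < scatteringLength v → ∀ M : ℝ, 0 < M →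
    ∀ e : ℝ, 0 < e → ∃ ρ₀ : ℝ, 0 < ρ₀ ∧ ∀ ρ : ℝ, 0 < ρ → ρ < ρ₀ → ∀ n : ℕ, ∀ K : ℕ, 0 < K →
      InWindow (M * ρ ^ (-(η : ℝ))) ρ (sideLength ρ (n + 1)) K →
      ∀ m : SubIdx K → ℕ, ∑ B, m B = n + 1 →
        ENNReal.ofReal (4 * Real.pi * ρ * (scatteringLength v).toReal * (1 - e) * ((n + 1 : ℕ) : ℝ)) *
            (1 + truncWeight K (((n + 1 : ℕ) : ℝ) / (K : ℝ) ^ 3) m) ≤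
          (∑ B : SubIdx K, neumannGroundStateEnergy v (m B) (sideLength ρ (n + 1) / (K : ℝ))) +
            ENNReal.ofReal (4 * Real.pi * ρ * (scatteringLength v).toReal * e * ((n + 1 : ℕ) : ℝ))

/-- **S3 — from the closed form to the `C¹` core, with the truncated variance.** If `closedEnergy v L Φ < E`
then for every `δ > 0` some trial state `Ψ` has `energy v Ψ < E` and
`countVarianceTrunc L K Φ ≤ countVarianceTrunc L K |Ψ| + δ`.  Why plausibly true: `closedEnergy` is the infimum
over `L²`-approximating trial sequences of `liminf energy` (`closedEnergy_le_liminf` is the definition), so some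
`Φ_k → Φ` in `L²` has `energy (Φ_k) < E` frequently; and `countVarianceTrunc` has integrand `[0,1]·(Φ⁺)²`, so
`V_T(Φ) ≤ V_T(|Φ_k|) + ‖Φ − Φ_k‖₂(‖Φ‖₂ + ‖Φ_k‖₂)`.  Size M.  (Source: Kato1966, VI §1.3 Thm 1.16; proved in-file, so not a cited fact.) -/
def ClosedToTrial : Prop :=
  ∀ (v : ℝ → ℝ≥0∞) (n : ℕ) (L : ℝ) (K : ℕ) (Φ : Config (n + 1) → ℝ), Measurable Φ →
    ∀ E : ℝ≥0∞, closedEnergy v L (fun X => (Φ X : ℂ)) < E → ∀ δ : ℝ≥0∞, 0 < δ →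
      ∃ Ψ : TrialState (n + 1) L, energy v Ψ < E ∧
        countVarianceTrunc L K Φ ≤ countVarianceTrunc L K (fun X => ‖Ψ.ψ X‖) + δ

/-- S1 is a theorem (tree-importing file `BoxCountShadowCellEnergy`). [cite: LSSY2005, (2.52)–(2.53)] -/
theorem cellDecomposition : CellDecomposition :=
  cellDecomposition_holds

/-- S2 is a theorem (tree-importing file `BoxCountShadowCellProfile`). [cite: LSSY2005, Thm. 2.4 and (2.53)–(2.59)] -/
theorem cellProfile (η : ℝ≥0) : CellProfile η :=
  cellProfile_holds η

/-- S3 is a theorem (tree-importing file `BoxCountShadowClosedToTrial`). [cite: Kato1966, VI §1.3 Thm 1.16] -/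
theorem closedToTrial : ClosedToTrial :=
  closedToTrial_holds

/-! ### Proved glue -/

/-- **The horizon cells tile the box**: `Σ_B N_B(X) = N` for `X ∈ Λ_L^N` (`K ≥ 1`, cells of side `L/K`).
[folklore] -/
theorem sum_countVec_eq {N : ℕ} {L : ℝ} (hL : 0 < L) {K : ℕ} (hK : 0 < K) {X : Config N}
    (hX : X ∈ boxN N L) : ∑ B : SubIdx K, countVec (L / (K : ℝ)) K X B = N := by
  classical
  have hKr : (0 : ℝ) < K := Nat.cast_pos.2 hK
  have hℓ : 0 < L / (K : ℝ) := div_pos hL hKr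
  have hKℓ : (K : ℝ) * (L / (K : ℝ)) = L := mul_div_cancel₀ L hKr.ne'
  have hcell : ∀ i, X i ∈ cell ((K : ℝ) * (L / (K : ℝ))) := fun i => by
    rw [hKℓ]
    exact fun k => Set.Ioo_subset_Ico_self (hX i k)
  have h1 : ∀ i, ∑ B : SubIdx K, (subCell (L / (K : ℝ)) B).indicator (fun _ => (1 : ℝ≥0∞)) (X i) = 1 := by
    intro i
    rw [sum_indicator_subCell hℓ (fun _ => (1 : ℝ≥0∞)) (X i), Set.indicator_of_mem (hcell i)]
  have h2 : (((∑ B : SubIdx K, countVec (L / (K : ℝ)) K X B : ℕ)) : ℝ≥0∞) = N := by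
    push_cast
    simp_rw [natCast_countVec]
    rw [Finset.sum_comm]
    simp_rw [h1]
    simp
  exact_mod_cast h2

/-- `∫ w_K(N(X)) |ψ(X)|² dX = countVarianceTrunc L K |ψ|` (swap the finite sum and the integral). [folklore] -/
theorem lintegral_truncWeight_mul (L : ℝ) (K : ℕ) {ψ : Config (n + 1) → ℂ} (hψ : Measurable ψ) :
    ∫⁻ X, truncWeight K (((n + 1 : ℕ) : ℝ) / (K : ℝ) ^ 3) (countVec (L / (K : ℝ)) K X) *
        (‖ψ X‖₊ : ℝ≥0∞) ^ 2 = countVarianceTrunc L K (fun X => ‖ψ X‖) := by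
  have hn : ∀ X, ENNReal.ofReal ‖ψ X‖ = (‖ψ X‖₊ : ℝ≥0∞) := fun X => by
    rw [← coe_nnnorm, ENNReal.ofReal_coe_nnreal]
  have hΦm : Measurable fun X => ‖ψ X‖ := hψ.norm
  have hmeas : ∀ B : SubIdx K, Measurable fun X : Config (n + 1) =>
      ENNReal.ofReal (min ((((countVec (L / (K : ℝ)) K X B : ℕ) : ℝ) /
        (((n + 1 : ℕ) : ℝ) / (K : ℝ) ^ 3) - 1) ^ 2) 1) * (‖ψ X‖₊ : ℝ≥0∞) ^ 2 := by
    intro B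
    simpa only [hn] using
      measurable_varTermTrunc (ℓ := L / (K : ℝ)) B (((n + 1 : ℕ) : ℝ) / (K : ℝ) ^ 3) hΦm
  unfold truncWeight countVarianceTrunc
  simp_rw [Finset.sum_mul, mul_assoc]
  rw [lintegral_finsetSum Finset.univ
    (f := fun B X => blockWeight K ^ 2 * (ENNReal.ofReal (min ((((countVec (L / (K : ℝ)) K X B : ℕ) : ℝ) /
        (((n + 1 : ℕ) : ℝ) / (K : ℝ) ^ 3) - 1) ^ 2) 1) * (‖ψ X‖₊ : ℝ≥0∞) ^ 2))
    fun B _ => (hmeas B).const_mul _]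
  refine Finset.sum_congr rfl fun B _ => ?_
  rw [lintegral_const_mul _ (hmeas B)]
  refine congrArg _ (lintegral_congr fun X => ?_)
  rw [hn X]

/-- **Trial-state coercivity from S1 and an instance of S2**: if `c₁(1 + w_K(m)) ≤ Σ_B E₀^N(m_B, L/K) + c₂` for
every count vector of total `N`, then `c₁(1 + countVarianceTrunc L K |Ψ|) ≤ ⟨Ψ, HΨ⟩ + c₂` for every trial state
(multiply pointwise by `|Ψ(X)|²` — off the box `Ψ = 0` — and integrate). [folklore] -/
theorem trialCoercivity (hdec : CellDecomposition) {v : ℝ → ℝ≥0∞} (hvm : Measurable v) {L : ℝ}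
    (hL : 0 < L) {K : ℕ} (hK : 0 < K) {c₁ c₂ : ℝ≥0∞}
    (hP : ∀ m : SubIdx K → ℕ, ∑ B, m B = n + 1 →
      c₁ * (1 + truncWeight K (((n + 1 : ℕ) : ℝ) / (K : ℝ) ^ 3) m) ≤
        (∑ B : SubIdx K, neumannGroundStateEnergy v (m B) (L / (K : ℝ))) + c₂)
    (Ψ : TrialState (n + 1) L) :
    c₁ * (1 + countVarianceTrunc L K (fun X => ‖Ψ.ψ X‖)) ≤ energy v Ψ + c₂ := by
  classical
  have hψm : Measurable Ψ.ψ := Ψ.contDiff.continuous.measurable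
  have hgm : Measurable fun X => (‖Ψ.ψ X‖₊ : ℝ≥0∞) ^ 2 :=
    (hψm.nnnorm.coe_nnreal_ennreal).pow_const 2
  -- pointwise
  have hpt : ∀ X, c₁ * ((1 + truncWeight K (((n + 1 : ℕ) : ℝ) / (K : ℝ) ^ 3)
      (countVec (L / (K : ℝ)) K X)) * (‖Ψ.ψ X‖₊ : ℝ≥0∞) ^ 2) ≤
      cellEnergySum v L K X * (‖Ψ.ψ X‖₊ : ℝ≥0∞) ^ 2 + c₂ * (‖Ψ.ψ X‖₊ : ℝ≥0∞) ^ 2 := by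
    intro X
    by_cases hX : X ∈ boxN (n + 1) L
    · have h : c₁ * (1 + truncWeight K (((n + 1 : ℕ) : ℝ) / (K : ℝ) ^ 3) (countVec (L / (K : ℝ)) K X)) ≤
          cellEnergySum v L K X + c₂ := hP _ (sum_countVec_eq hL hK hX)
      calc c₁ * ((1 + truncWeight K (((n + 1 : ℕ) : ℝ) / (K : ℝ) ^ 3) (countVec (L / (K : ℝ)) K X)) *
            (‖Ψ.ψ X‖₊ : ℝ≥0∞) ^ 2)
          = (c₁ * (1 + truncWeight K (((n + 1 : ℕ) : ℝ) / (K : ℝ) ^ 3) (countVec (L / (K : ℝ)) K X))) *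
            (‖Ψ.ψ X‖₊ : ℝ≥0∞) ^ 2 := (mul_assoc _ _ _).symm
        _ ≤ (cellEnergySum v L K X + c₂) * (‖Ψ.ψ X‖₊ : ℝ≥0∞) ^ 2 := mul_le_mul' h le_rfl
        _ = _ := add_mul _ _ _
    · have h0 : Ψ.ψ X = 0 := Ψ.eq_zero X hX
      simp [h0]
  -- integrate
  calc c₁ * (1 + countVarianceTrunc L K (fun X => ‖Ψ.ψ X‖))
      = c₁ * ((∫⁻ X, (‖Ψ.ψ X‖₊ : ℝ≥0∞) ^ 2) + ∫⁻ X, truncWeight K (((n + 1 : ℕ) : ℝ) / (K : ℝ) ^ 3)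
          (countVec (L / (K : ℝ)) K X) * (‖Ψ.ψ X‖₊ : ℝ≥0∞) ^ 2) := by
        rw [Ψ.norm_eq, lintegral_truncWeight_mul L K hψm]
    _ = c₁ * ∫⁻ X, (1 + truncWeight K (((n + 1 : ℕ) : ℝ) / (K : ℝ) ^ 3)
          (countVec (L / (K : ℝ)) K X)) * (‖Ψ.ψ X‖₊ : ℝ≥0∞) ^ 2 := by
        rw [← lintegral_add_left hgm]
        congr 1
        refine lintegral_congr fun X => ?_
        rw [add_mul, one_mul]
    _ ≤ ∫⁻ X, c₁ * ((1 + truncWeight K (((n + 1 : ℕ) : ℝ) / (K : ℝ) ^ 3)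
          (countVec (L / (K : ℝ)) K X)) * (‖Ψ.ψ X‖₊ : ℝ≥0∞) ^ 2) := lintegral_const_mul_le _ _
    _ ≤ ∫⁻ X, cellEnergySum v L K X * (‖Ψ.ψ X‖₊ : ℝ≥0∞) ^ 2 + c₂ * (‖Ψ.ψ X‖₊ : ℝ≥0∞) ^ 2 :=
        lintegral_mono hpt
    _ = (∫⁻ X, cellEnergySum v L K X * (‖Ψ.ψ X‖₊ : ℝ≥0∞) ^ 2) +
          ∫⁻ X, c₂ * (‖Ψ.ψ X‖₊ : ℝ≥0∞) ^ 2 := lintegral_add_right _ (measurable_const.mul hgm)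
    _ = (∫⁻ X, cellEnergySum v L K X * (‖Ψ.ψ X‖₊ : ℝ≥0∞) ^ 2) + c₂ * ∫⁻ X, (‖Ψ.ψ X‖₊ : ℝ≥0∞) ^ 2 := by
        rw [lintegral_const_mul _ hgm]
    _ ≤ energy v Ψ + c₂ := by
        rw [Ψ.norm_eq, mul_one]
        exact add_le_add (hdec v hvm n L hL K hK Ψ) le_rfl

/-! ### The composition -/

/-- **COERC_h from the three pieces** (kernel-checked composition; the conclusion is the node decl BY NAME).
Given `s, M`: `s' = min s 1`, `e = ε = s'/16`; for a measurable Bose-symmetric `Φ` with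
`closedEnergy ≤ 4πρa(1+ε)N < 4πρa(1+2ε)N`, S3 gives a trial state `Ψ` with energy `< 4πρa(1+2ε)N` and
`V_T(Φ) ≤ V_T(|Ψ|) + s'/2`; S1+S2 give `4πρa(1−e)N(1 + V_T(|Ψ|)) ≤ 4πρa(1+3e)N`, so
`V_T(|Ψ|) ≤ 4e/(1−e) ≤ s'/2`. [folklore] -/
theorem GroundStateHorizonCellCoercivity_of (η : ℝ≥0) (hdec : CellDecomposition)
    (hprof : CellProfile η) (hct : ClosedToTrial) : GroundStateHorizonCellCoercivity η := by
  intro v hv ha s hs M hM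
  have hfin : scatteringLength v ≠ ⊤ := IsRepulsiveFiniteRange.scatteringLength_ne_top hv
  have ha0 : 0 < (scatteringLength v).toReal := ENNReal.toReal_pos ha.ne' hfin
  set s' : ℝ := min s 1 with hs'def
  have hs'0 : 0 < s' := lt_min hs one_pos
  have hs'1 : s' ≤ 1 := min_le_right _ _
  have hs's : s' ≤ s := min_le_left _ _
  set e : ℝ := s' / 16 with hedef
  have he0 : 0 < e := by positivity
  have he1 : e ≤ 1 / 16 := by rw [hedef]; linarith
  obtain ⟨ρ₀, hρ₀, hP⟩ := hprof v hv ha M hM e he0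
  refine ⟨e, he0, ρ₀, hρ₀, fun ρ hρ hρlt => Filter.Eventually.of_forall fun n => ?_⟩
  intro Φ hΦm _hΦsymm hΦE K hK hKw
  have hN0 : (0 : ℝ) < ((n + 1 : ℕ) : ℝ) := by positivity
  have hL : 0 < sideLength ρ (n + 1) := by
    unfold sideLength
    exact Real.rpow_pos_of_pos (div_pos hN0 hρ) _
  set A : ℝ := 4 * Real.pi * ρ * (scatteringLength v).toReal with hAdef
  have hA0 : 0 < A := by positivity
  have hAN : 0 < A * ((n + 1 : ℕ) : ℝ) := mul_pos hA0 hN0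
  -- the strict energy level `4πρa(1+2e)N`
  have hlt : closedEnergy v (sideLength ρ (n + 1)) (fun X => (Φ X : ℂ)) <
      ENNReal.ofReal (A * (1 + 2 * e) * ((n + 1 : ℕ) : ℝ)) := by
    refine lt_of_le_of_lt hΦE ?_
    rw [ENNReal.ofReal_lt_ofReal_iff (by positivity)]
    nlinarith
  obtain ⟨Ψ, hΨE, hΨV⟩ := hct v n (sideLength ρ (n + 1)) K Φ hΦm _ hlt (ENNReal.ofReal (s' / 2))
    (ENNReal.ofReal_pos.2 (by positivity))
  -- trial coercivity for `Ψ`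
  have key : ENNReal.ofReal (A * (1 - e) * ((n + 1 : ℕ) : ℝ)) *
      (1 + countVarianceTrunc (sideLength ρ (n + 1)) K (fun X => ‖Ψ.ψ X‖)) ≤
      energy v Ψ + ENNReal.ofReal (A * e * ((n + 1 : ℕ) : ℝ)) :=
    trialCoercivity hdec hv.1 hL hK (hP ρ hρ hρlt n K hK hKw) Ψ
  set V : ℝ≥0∞ := countVarianceTrunc (sideLength ρ (n + 1)) K (fun X => ‖Ψ.ψ X‖) with hVdef
  have h2 : ENNReal.ofReal (A * (1 - e) * ((n + 1 : ℕ) : ℝ)) * (1 + V) ≤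
      ENNReal.ofReal (A * (1 + 3 * e) * ((n + 1 : ℕ) : ℝ)) := by
    refine key.trans ?_
    calc energy v Ψ + ENNReal.ofReal (A * e * ((n + 1 : ℕ) : ℝ))
        ≤ ENNReal.ofReal (A * (1 + 2 * e) * ((n + 1 : ℕ) : ℝ)) +
            ENNReal.ofReal (A * e * ((n + 1 : ℕ) : ℝ)) := add_le_add hΨE.le le_rfl
      _ = ENNReal.ofReal (A * (1 + 3 * e) * ((n + 1 : ℕ) : ℝ)) := by
          rw [← ENNReal.ofReal_add (by positivity) (by positivity)]
          ring_nf
  have h1e : 0 < 1 - e := by linarith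
  have hc0 : ENNReal.ofReal (A * (1 - e) * ((n + 1 : ℕ) : ℝ)) ≠ 0 :=
    (ENNReal.ofReal_pos.2 (mul_pos (mul_pos hA0 h1e) hN0)).ne'
  have h3 : 1 + V ≤ ENNReal.ofReal ((1 + 3 * e) / (1 - e)) := by
    rw [mul_comm] at h2
    have h := (ENNReal.le_div_iff_mul_le (Or.inl hc0) (Or.inl ENNReal.ofReal_ne_top)).2 h2
    rw [← ENNReal.ofReal_div_of_pos (mul_pos (mul_pos hA0 h1e) hN0)] at h
    refine h.trans (le_of_eq (congrArg ENNReal.ofReal ?_))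
    rw [mul_right_comm A (1 + 3 * e), mul_right_comm A (1 - e), mul_div_mul_left _ _ hAN.ne']
  have h4 : V ≤ ENNReal.ofReal ((1 + 3 * e) / (1 - e) - 1) := by
    have hV : V = (1 + V) - 1 := (ENNReal.add_sub_cancel_left ENNReal.one_ne_top).symm
    rw [hV, ENNReal.ofReal_sub _ zero_le_one, ENNReal.ofReal_one]
    exact tsub_le_tsub_right h3 1
  have h5 : (1 + 3 * e) / (1 - e) - 1 ≤ s' / 2 := by
    rw [div_sub_one h1e.ne', div_le_iff₀ h1e]
    nlinarith
  calc countVarianceTrunc (sideLength ρ (n + 1)) K Φ ≤ V + ENNReal.ofReal (s' / 2) := hΨV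
    _ ≤ ENNReal.ofReal (s' / 2) + ENNReal.ofReal (s' / 2) :=
        add_le_add (h4.trans (ENNReal.ofReal_le_ofReal h5)) le_rfl
    _ = ENNReal.ofReal s' := by
        rw [← ENNReal.ofReal_add (by positivity) (by positivity)]
        ring_nf
    _ ≤ ENNReal.ofReal s := ENNReal.ofReal_le_ofReal hs's

/-! ### COERC_h, DLT_h, RSH_h are theorems; MARG_h rests on DISP_h alone -/

/-- **COERC_h(η) holds for every `η ≥ 0`**: cell coercivity of the truncated count variance at the horizon scale
`ℓ_h = Mρ^{-η}/√ρ` for all low-energy Bose-symmetric states. [cite: LSSY2005, Thm. 2.4, (2.52)–(2.59)] -/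
theorem groundStateHorizonCellCoercivity_holds (η : ℝ≥0) : GroundStateHorizonCellCoercivity η :=
  GroundStateHorizonCellCoercivity_of η cellDecomposition (cellProfile η) closedToTrial

/-- **DLT_h(η) holds**: the TRUNCATED density law of large numbers for the ground state at every horizon scale
(through the tree's Dyson upper bound, `densityLLNTrunc_of_coercivity`). [cite: LSSY2005, Thm. 2.2 and Thm. 2.4] -/
theorem densityLLNTrunc_holds (η : ℝ≥0) : GroundStateHorizonDensityLLNTrunc η :=
  densityLLNTrunc_of_coercivity η (groundStateHorizonCellCoercivity_holds η)

/-- **RSH_h(η) holds**: the horizon ring share is a theorem (`horizonRingShare_of_densityLLNTrunc`, θ = 1/40).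
[cite: LSSY2005, Thm. 2.2 and Thm. 2.4] -/
theorem horizonRingShare_holds (η : ℝ≥0) : GroundStateHorizonRingShare η :=
  horizonRingShare_of_coercivity η (groundStateHorizonCellCoercivity_holds η)

/-- **DISP_h ⟹ INS_h**: with the ring share discharged, cell insertion rests on displacement alone. [folklore] -/
theorem horizonCellInsertion_of_displacement' (η : ℝ≥0) (hdisp : GroundStateHorizonDisplacement η) :
    GroundStateHorizonCellInsertion η :=
  horizonCellInsertion_of_coercivity η hdisp (groundStateHorizonCellCoercivity_holds η)

/-- **DISP_h ⟹ MARG_h**: the residual of record `GroundStateHorizonCellCountAffinity η` rests on the (non-energy)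
displacement statement ALONE. [folklore] -/
theorem horizonCellCountAffinity_of_displacement' (η : ℝ≥0) (hdisp : GroundStateHorizonDisplacement η) :
    GroundStateHorizonCellCountAffinity η :=
  horizonCellCountAffinity_of_coercivity η hdisp (groundStateHorizonCellCoercivity_holds η)

/-- The kernel through the displacement door with the ring share DISCHARGED:
UGS → LOC_h(η) → DISP_h(η) → CSUF_h(η) → SUF_h(η) → `BoseEinsteinCondensation`. [folklore] -/
theorem bec_of_displacement₃ (η : ℝ≥0) (hU : BoxGroundStateUniqueness)
    (hloc : GroundStateHorizonCondensation η) (hdisp : GroundStateHorizonDisplacement η)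
    (hcsuf : GroundStateHorizonCellCountSufficiency η) (hsuf : GroundStateHorizonCountSufficiency η) :
    _root_.BoseEinsteinCondensation :=
  bec_of_coercivity₀ η hU hloc (groundStateHorizonCellCoercivity_holds η) hdisp hcsuf hsuf

end Summit.AtomisticToContinuum.BoseEinsteinCondensation.Theorems.BoxCountShadow.CoercivityLine
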